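import Mathlib.Analysis.InnerProductSpace.PiL2
import Mathlib.Analysis.SpecialFunctions.Complex.Arg
import Mathlib.Analysis.SpecialFunctions.Trigonometric.Bounds
import Mathlib.Analysis.Real.Pi.Bounds
import Mathlib.Algebra.Order.ToIntervalMod
import Mathlib.Algebra.Order.Floor.Ring
import Literature.MathematicalPhysics.StatisticalMechanics.Theil2006
import HarnessLib

/-!
# Theil 2006, Proposition 2.3 (7), (18): the combinatorial bound on short-range bonds — proof

Topic `Literature/MathematicalPhysics/StatisticalMechanics`. DISCHARGE of the named fact
`Literature.MathematicalPhysics.StatisticalMechanics.Theil2006_shortRangeBonds` of `Theil2006.lean`: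
`Theil2006_shortRangeBonds_holds : Theil2006_shortRangeBonds`, sorry-free, so that users of the
fact feed `Theil2006_shortRangeBonds_holds` for `(h : Theil2006_shortRangeBonds)`.

## Source and what is proved

F. Theil, *A proof of crystallization in two dimensions*, Comm. Math. Phys. **262** (2006)
209–236, §2.2, Proposition 2.3 with (7) and (18): there is `α₀ > 0` such that for `α ∈ (0, α₀)`
and every configuration `y : X_N → ℝ²` with `min_{x ≠ x'} |y(x) - y(x')| > 1 - α` (13),
(7) `#𝒮(y) ≤ 3N - ½ #∂X(y)` and (18) `#𝒩(x) ≤ 7` for all `x`. We prove it with the explicit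
threshold `α₀ = 1/50`.

## Proof architecture (Theil 2006, §2.2, proof of Proposition 2.3)

1. **(18), at most six neighbours** (`card_filter_shortRange_le_six`). The neighbours `x'` of `x`
   sit in the annulus `1-α ≤ |y(x') - y(x)| ≤ 1+α` and are mutually `(1-α)`-separated. By the law
   of cosines (`norm_sub_sq_eq_cos_arg`, in complex coordinates centred at `y(x)`), two points of
   the annulus whose arguments differ by at most `2π/7` modulo `2π` are closer than `1-α` once
   `α ≤ 1/50` (`norm_sub_lt_of_cos_eq`, using `cos t ≥ 1 - t²/2 ≥ 0.595` for `|t| ≤ 2π/7`,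
   `cos_ge_of_abs_le`). Hence, fixing one neighbour `x₁`, the arguments of the other neighbours
   relative to `x₁`, normalised to `[0, 2π)`, lie in `[2π/7, 12π/7)`, i.e. in five boxes
   `[2πm/7, 2π(m+1)/7)`, `m = 1, …, 5`, each holding at most one neighbour (pigeonhole): at most
   `1 + 5 = 6` neighbours, so `#𝒩(x) ≤ 7`.
2. **(7), double counting** (`two_mul_card_shortRangePairs`). `2 #𝒮(y) = ∑_x (#𝒩(x) - 1)`, and
   `#𝒩(x) - 1 = 6` off `∂X(y)`, `≤ 5` on `∂X(y)` by step 1; so `2 #𝒮 ≤ 6N - #∂X`.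
-/

noncomputable section

open scoped BigOperators Real
open Complex (arg)

namespace Literature.MathematicalPhysics.StatisticalMechanics

namespace Theil2006

/-! ### Plane geometry: the law of cosines and the angular separation of annulus points -/

/-- Law of cosines in `ℂ`: `|z - w|² = |z|² + |w|² - 2 |z| |w| cos(arg z - arg w)`. [folklore] -/
theorem norm_sub_sq_eq_cos_arg (z w : ℂ) :
    ‖z - w‖ ^ 2 = ‖z‖ ^ 2 + ‖w‖ ^ 2 - 2 * (‖z‖ * ‖w‖ * Real.cos (arg z - arg w)) := by
  have hz := Complex.norm_mul_cos_arg z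
  have hz' := Complex.norm_mul_sin_arg z
  have hw := Complex.norm_mul_cos_arg w
  have hw' := Complex.norm_mul_sin_arg w
  simp only [Complex.sq_norm, Complex.normSq_sub, Complex.mul_re, Complex.conj_re, Complex.conj_im,
    Real.cos_sub]
  linear_combination (2 * (‖w‖ * Real.cos (arg w))) * hz + (2 * z.re) * hw +
    (2 * (‖w‖ * Real.sin (arg w))) * hz' + (2 * z.im) * hw'

/-- `cos t ≥ 0.595` for `|t| ≤ 2π/7`, from `cos t ≥ 1 - t²/2` and `π < 3.15`. [folklore] -/
theorem cos_ge_of_abs_le {t : ℝ} (ht : |t| ≤ 2 * π / 7) : 119 / 200 ≤ Real.cos t := by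
  have h1 : 1 - t ^ 2 / 2 ≤ Real.cos t := Real.one_sub_sq_div_two_le_cos
  have hπ : π < 3.15 := Real.pi_lt_d2
  have ht' : t ^ 2 ≤ (2 * π / 7) ^ 2 := by
    rw [← sq_abs t]
    exact pow_le_pow_left₀ (abs_nonneg t) ht 2
  nlinarith [mul_self_lt_mul_self Real.pi_pos.le hπ]

/-- Two points of the annulus `1-α ≤ |·| ≤ 1+α` (`0 < α ≤ 1/50`) whose arguments differ by at
most `2π/7` modulo `2π` are at distance `< 1-α`. [folklore] -/
theorem norm_sub_lt_of_cos_eq {α : ℝ} (hα : 0 < α) (hα' : α ≤ 1 / 50) {z w : ℂ}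
    (hz : 1 - α ≤ ‖z‖) (hz' : ‖z‖ ≤ 1 + α) (hw : 1 - α ≤ ‖w‖) (hw' : ‖w‖ ≤ 1 + α) {t : ℝ}
    (ht : Real.cos (arg z - arg w) = Real.cos t) (ht' : |t| ≤ 2 * π / 7) : ‖z - w‖ < 1 - α := by
  have hcos : 119 / 200 ≤ Real.cos (arg z - arg w) := ht ▸ cos_ge_of_abs_le ht'
  have hsq : ‖z - w‖ ^ 2 < (1 - α) ^ 2 := by
    rw [norm_sub_sq_eq_cos_arg]
    have h0 : 0 ≤ ‖z‖ * ‖w‖ * (Real.cos (arg z - arg w) - 119 / 200) :=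
      mul_nonneg (mul_nonneg (norm_nonneg _) (norm_nonneg _)) (sub_nonneg.2 hcos)
    nlinarith [mul_nonneg (sub_nonneg.2 hz) (sub_nonneg.2 hz'),
      mul_nonneg (sub_nonneg.2 hw) (sub_nonneg.2 hw'), mul_nonneg (sub_nonneg.2 hz) (sub_nonneg.2 hw),
      mul_nonneg (sub_nonneg.2 hz') hα.le, mul_nonneg (sub_nonneg.2 hw') hα.le,
      mul_nonneg hα.le (sub_nonneg.2 hα')]
  exact lt_of_pow_lt_pow_left₀ 2 (by linarith) hsq

/-! ### (18): at most six neighbours -/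

/-- **Theil 2006, (18)**: in a `(1-α)`-separated planar configuration (`0 < α ≤ 1/50`) every
particle `x` has at most six others at distance in `[1-α, 1+α]`, i.e. `#𝒩(x) ≤ 7`.
[cite: Theil2006, §2.2 Proposition 2.3 (18)] -/
theorem card_filter_shortRange_le_six {α : ℝ} (hα : 0 < α) (hα' : α ≤ 1 / 50) {N : ℕ}
    (y : Fin N → Plane) (hsep : ∀ i j : Fin N, i ≠ j → 1 - α < dist (y i) (y j)) (x : Fin N) :
    (Finset.univ.filter fun x' => |dist (y x) (y x') - 1| ≤ α).card ≤ 6 := by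
  set S := Finset.univ.filter fun x' => |dist (y x) (y x') - 1| ≤ α with hS
  by_contra! hcard
  -- complex coordinates centred at `y x`
  obtain ⟨z, hz⟩ : ∃ z : Fin N → ℂ, ∀ x', z x' = Complex.orthonormalBasisOneI.repr.symm (y x' - y x) :=
    ⟨_, fun _ => rfl⟩
  have hnorm : ∀ x', ‖z x'‖ = dist (y x) (y x') := by
    intro x'
    rw [hz, LinearIsometryEquiv.norm_map, ← dist_eq_norm, dist_comm]
  have hsub : ∀ x' x'', ‖z x' - z x''‖ = dist (y x') (y x'') := by
    intro x' x''
    rw [hz, hz, ← map_sub, LinearIsometryEquiv.norm_map, sub_sub_sub_cancel_right, dist_eq_norm]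
  have hmem : ∀ x' ∈ S, 1 - α ≤ ‖z x'‖ ∧ ‖z x'‖ ≤ 1 + α := by
    intro x' hx'
    rw [hS, Finset.mem_filter] at hx'
    have := abs_le.1 hx'.2
    rw [hnorm]
    constructor <;> linarith
  -- two distinct neighbours subtend an angle `> 2π/7` at `y x`
  have hang : ∀ x' ∈ S, ∀ x'' ∈ S, x' ≠ x'' → ∀ t : ℝ,
      Real.cos (arg (z x') - arg (z x'')) = Real.cos t → 2 * π / 7 < |t| := by
    intro x' hx' x'' hx'' hne t ht
    by_contra! hle
    have h1 := norm_sub_lt_of_cos_eq hα hα' (hmem x' hx').1 (hmem x' hx').2 (hmem x'' hx'').1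
      (hmem x'' hx'').2 ht hle
    rw [hsub] at h1
    exact lt_asymm h1 (hsep x' x'' hne)
  obtain ⟨x₁, hx₁⟩ : S.Nonempty := Finset.card_pos.1 (by omega)
  -- arguments relative to `z x₁`, normalised to `[0, 2π)`
  obtain ⟨φ, hφ⟩ : ∃ φ : Fin N → ℝ, ∀ x', φ x' = toIcoMod Real.two_pi_pos 0 (arg (z x') - arg (z x₁)) :=
    ⟨_, fun _ => rfl⟩
  obtain ⟨n, hn⟩ : ∃ n : Fin N → ℤ, ∀ x', n x' = toIcoDiv Real.two_pi_pos 0 (arg (z x') - arg (z x₁)) :=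
    ⟨_, fun _ => rfl⟩
  have hφn : ∀ x', arg (z x') - arg (z x₁) = φ x' + n x' * (2 * π) := by
    intro x'
    rw [hφ, hn, ← zsmul_eq_mul]
    exact (toIcoMod_add_toIcoDiv_zsmul _ _ _).symm
  have hφmem : ∀ x', 0 ≤ φ x' ∧ φ x' < 2 * π := by
    intro x'
    have h := toIcoMod_mem_Ico Real.two_pi_pos 0 (arg (z x') - arg (z x₁))
    rw [zero_add, ← hφ] at h
    exact h
  have hcos₁ : ∀ x', Real.cos (arg (z x') - arg (z x₁)) = Real.cos (φ x') := by
    intro x'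
    rw [hφn, Real.cos_add_int_mul_two_pi]
  have h2π : 0 < 2 * π := Real.two_pi_pos
  -- the other neighbours fall into five boxes of angular width `2π/7`
  have hmaps : Set.MapsTo (fun x' => ⌊7 * φ x' / (2 * π)⌋) ↑(S.erase x₁) ↑(Finset.Icc (1 : ℤ) 5) := by
    intro x' hx'
    obtain ⟨hne, hx'S⟩ := Finset.mem_erase.1 (Finset.mem_coe.1 hx')
    have key := hang x' hx'S x₁ hx₁ hne
    refine Finset.mem_coe.2 (Finset.mem_Icc.2 ⟨?_, ?_⟩)
    · by_contra! hlt
      have h7 : 7 * φ x' / (2 * π) < 1 := by exact_mod_cast Int.floor_lt.1 hlt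
      rw [div_lt_one h2π] at h7
      have := key (φ x') (hcos₁ x')
      rw [abs_of_nonneg (hφmem x').1] at this
      linarith
    · by_contra! hlt
      have h6 : (6 : ℤ) ≤ ⌊7 * φ x' / (2 * π)⌋ := by omega
      have h7 : (6 : ℝ) ≤ 7 * φ x' / (2 * π) := by exact_mod_cast Int.le_floor.1 h6
      rw [le_div_iff₀ h2π] at h7
      have := key (φ x' - 2 * π) (by rw [hcos₁, Real.cos_sub_two_pi])
      rw [abs_of_nonpos (by linarith [(hφmem x').2])] at this
      linarith
  have hlt : (Finset.Icc (1 : ℤ) 5).card < (S.erase x₁).card := by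
    rw [Finset.card_erase_of_mem hx₁, Int.card_Icc]
    norm_num
    omega
  obtain ⟨x', hx', x'', hx'', hne, heq⟩ := Finset.exists_ne_map_eq_of_card_lt_of_maps_to hlt hmaps
  have hx'S := (Finset.mem_erase.1 hx').2
  have hx''S := (Finset.mem_erase.1 hx'').2
  -- two neighbours in one box: argument difference `< 2π/7`
  have h1 : |7 * φ x' / (2 * π) - 7 * φ x'' / (2 * π)| < 1 := Int.abs_sub_lt_one_of_floor_eq_floor heq
  have h2 : |φ x' - φ x''| < 2 * π / 7 := by
    have h72 : (0 : ℝ) < 7 / (2 * π) := by positivity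
    have : 7 * φ x' / (2 * π) - 7 * φ x'' / (2 * π) = (φ x' - φ x'') * (7 / (2 * π)) := by ring
    rw [this, abs_mul, abs_of_pos h72, ← lt_div_iff₀ h72, one_div_div] at h1
    exact h1
  have hcosd : Real.cos (arg (z x') - arg (z x'')) = Real.cos (φ x' - φ x'') := by
    have : arg (z x') - arg (z x'') = (φ x' - φ x'') + ((n x' - n x'' : ℤ) : ℝ) * (2 * π) := by
      have e1 := hφn x'
      have e2 := hφn x''
      push_cast
      linarith
    rw [this, Real.cos_add_int_mul_two_pi]
  linarith [hang x' hx'S x'' hx''S hne _ hcosd]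

/-! ### (7): double counting -/

/-- Double counting of the short-range bonds (handshake): for `α < 1` (no particle is its own
neighbour), `2 #𝒮(y) = ∑_x #{x' | {x,x'} ∈ 𝒮(y)} = ∑_x (#𝒩(x) - 1)`.
[cite: Theil2006, §2.2 proof of Proposition 2.3] -/
theorem two_mul_card_shortRangePairs {α : ℝ} (hα : α < 1) {N : ℕ} (y : Fin N → Plane) :
    2 * (shortRangePairs α y).card =
      ∑ x : Fin N, (Finset.univ.filter fun x' => |dist (y x) (y x') - 1| ≤ α).card := by
  have hirr : ∀ a : Fin N, ¬ |dist (y a) (y a) - 1| ≤ α := by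
    intro a
    rw [dist_self, zero_sub, abs_neg, abs_one, not_le]
    exact hα
  set A := Finset.univ.filter fun p : Fin N × Fin N => |dist (y p.1) (y p.2) - 1| ≤ α with hA
  have hAcard : A.card = ∑ x : Fin N, (Finset.univ.filter fun x' => |dist (y x) (y x') - 1| ≤ α).card := by
    simp only [hA, Finset.card_filter, Fintype.sum_prod_type]
  have h1 : A.filter (fun p => p.1 < p.2) = shortRangePairs α y := by
    ext p
    simp only [hA, shortRangePairs, Finset.mem_filter, Finset.mem_univ, true_and]
    exact and_comm
  have h2 : (A.filter fun p => ¬ p.1 < p.2).card = (shortRangePairs α y).card := by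
    refine Finset.card_equiv (Equiv.prodComm (Fin N) (Fin N)) (fun p => ?_)
    simp only [hA, shortRangePairs, Finset.mem_filter, Finset.mem_univ, true_and,
      Equiv.prodComm_apply, Prod.fst_swap, Prod.snd_swap, not_lt]
    constructor
    · rintro ⟨hr, hle⟩
      refine ⟨lt_of_le_of_ne hle ?_, by rwa [dist_comm]⟩
      rintro heq
      rw [heq] at hr
      exact hirr _ hr
    · rintro ⟨hlt, hr⟩
      exact ⟨by rwa [dist_comm], hlt.le⟩
  have h3 := Finset.card_filter_add_card_filter_not (s := A) (fun p : Fin N × Fin N => p.1 < p.2)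
  rw [h1, h2] at h3
  omega

end Theil2006

open Theil2006

/-- DISCHARGE of `Theil2006_shortRangeBonds` — **Theil 2006, Proposition 2.3 (7), (18)** — with the
explicit threshold `α₀ = 1/50`: for `α ∈ (0, 1/50)` and every `(1-α)`-separated configuration
`y : X_N → ℝ²`, `#𝒮(y) ≤ 3N - ½ #∂X(y)` and `#𝒩(x) ≤ 7` for all `x`. Users of the named fact
feed `Theil2006_shortRangeBonds_holds` for `(h : Theil2006_shortRangeBonds)`.
[cite: Theil2006, §2.2 Proposition 2.3 (7) (18)] -/
theorem Theil2006_shortRangeBonds_holds : Theil2006_shortRangeBonds := by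
  refine ⟨1 / 50, by norm_num, fun α hα hα' N y hsep => ?_⟩
  have hS6 : ∀ x : Fin N, (Finset.univ.filter fun x' => |dist (y x) (y x') - 1| ≤ α).card ≤ 6 :=
    fun x => card_filter_shortRange_le_six hα hα'.le y hsep x
  have hnot : ∀ x : Fin N, x ∉ (Finset.univ.filter fun x' => |dist (y x) (y x') - 1| ≤ α) := by
    intro x
    rw [Finset.mem_filter, dist_self, zero_sub, abs_neg, abs_one, not_and, not_le]
    intro
    linarith
  have hnbhd : ∀ x : Fin N,
      (nbhd α y x).card = (Finset.univ.filter fun x' => |dist (y x) (y x') - 1| ≤ α).card + 1 := by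
    intro x
    rw [nbhd, Finset.card_insert_of_notMem (hnot x)]
  refine ⟨?_, fun x => by rw [hnbhd]; have := hS6 x; omega⟩
  have h2 := two_mul_card_shortRangePairs (by linarith : α < 1) y
  have hsum : ∑ x : Fin N, (Finset.univ.filter fun x' => |dist (y x) (y x') - 1| ≤ α).card +
      (defects α y).card ≤ 6 * N := by
    have hdef : (defects α y).card = ∑ x : Fin N, if (nbhd α y x).card ≠ 7 then 1 else 0 := by
      rw [defects, Finset.card_filter]
    rw [hdef, ← Finset.sum_add_distrib]
    calc ∑ x : Fin N, ((Finset.univ.filter fun x' => |dist (y x) (y x') - 1| ≤ α).card +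
          if (nbhd α y x).card ≠ 7 then 1 else 0)
        ≤ ∑ _x : Fin N, 6 := Finset.sum_le_sum fun x _ => by
          have h₁ := hnbhd x
          have h₂ := hS6 x
          split_ifs with h7 <;> omega
      _ = 6 * N := by simp [mul_comm]
  have hnat : 2 * (shortRangePairs α y).card + (defects α y).card ≤ 6 * N := by omega
  have hreal : ((2 * (shortRangePairs α y).card + (defects α y).card : ℕ) : ℝ) ≤ ((6 * N : ℕ) : ℝ) := by
    exact_mod_cast hnat
  push_cast at hreal
  linarith

end Literature.MathematicalPhysics.StatisticalMechanics

end
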